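/-
Copyright (c) 2026. All rights reserved.
Released under Apache 2.0 license as described in the file LICENSE.
Authors: abc-iut cell, seat abc-iut-w5-d024 (gen 5).
-/
import Literature.NumberTheory.GaloisRepresentations.WildInertiaTameStructure
import Literature.AnabelianGeometry.AbsoluteAnabelian.MLFGaloisTameStronglyComplete
import Literature.AnabelianGeometry.AbsoluteAnabelian.LocalUnramifiedQuotientH2
import Literature.GroupTheory.ProfiniteComplementLift
import Literature.GroupTheory.FreeProcyclicQuotientLift
import HarnessLib

/-!
# The wild inertia group of a `p`-adic field has a closed complement in `Γ_F`

`F` a non-archimedean local field of characteristic `0`, `Γ_F = Gal(F̄/F)`, `I_F = absInertia F`,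
`P_F = absWildInertia F ϖ` (`ϖ` a uniformiser).  The extension
`1 → P_F → Γ_F → Γ_F ⧸ P_F = Gal(F^tr/F) → 1` SPLITS: there is a closed subgroup `H ≤ Γ_F` with
`H ∩ P_F = 1` and `H · P_F = Γ_F` (`exists_closed_complement_absWildInertia`), i.e. `Γ_F ≅ P_F ⋊ Gal(F^tr/F)`
(Neukirch–Schmidt–Wingberg, proof of Thm. 7.5.3 / Jannsen–Wingberg §1: the tame quotient is
`p`-projective).  Here it is obtained from the abstract splitting theorem
`Literature.GroupTheory.exists_closed_complement_of_procyclic_quotient` (profinite Schur–Zassenhaus for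
`P_F ⊴ I_F`, Frattini argument, procyclic lift of the Frobenius) fed with the tree's tame structure:

* `isPGroup_map_absWildInertia_subgroupOf` — `P_F` is pro-`p` at the open normal levels of `I_F`
  (`absWildInertia_pow_mem_of_isOpen`);
* `coprime_index_map_absWildInertia_subgroupOf` — `I_F ⧸ P_F` is pro-`p′` at those levels
  (`isCyclic_map_absInertia_of_absWildInertia_le`);
* `topologicalClosure_zpowers_sup_absInertia_eq_top` — a Frobenius and `I_F` topologically generate
  `Γ_F` (`dense_zpowers_mk_of_isFrobPow`);
* `Γ_F ⧸ I_F ≅ Ẑ` is free procyclic (`isFreeProcyclic_quotient_galUnr`), so a procyclic supplement of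
  `I_F` meets it trivially (`Literature.GroupTheory.topologicalClosure_zpowers_inf_eq_bot_of_isFreeProcyclic`).

Corollary `exists_normalGenerators_absWildInertia_of_tfg`: if `Γ_F` is topologically finitely generated,
`P_F` is topologically generated by the `Γ_F`-conjugates of a finite set — a second, independent route to
`exists_topologicalClosure_normalClosure_eq_absWildInertia` (abc-iut-w6-d103, Jannsen–Wingberg finite
lemma).  Universe `0` for `F` (the profinite Schur–Zassenhaus conjugacy theorem of the tree is stated in
`Type`).  Proof-only; classical. [cite: NeukirchSchmidtWingberg2008, Thm. 7.5.3]
[cite: JannsenWingberg1982, §1]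
-/

noncomputable section

open scoped Pointwise Valued
open Field ValuativeRel

namespace Literature.NumberTheory.GaloisRepresentations

open GaloisRepresentations.IsNonarchimedeanLocalField
open Literature.AnabelianGeometry.AbsoluteAnabelian
open Literature.GroupTheory

/-! ### Closed complements give continuous sections -/

section Section

variable {G : Type*} [Group G] [TopologicalSpace G] [IsTopologicalGroup G] [CompactSpace G]

/-- **A closed complement is the image of a continuous section.** In a compact Hausdorff group, if the
closed normal subgroup `P` has a closed complement `H` (`H ⊓ P = ⊥`, `H ⊔ P = ⊤`), then `G → G ⧸ P`
has a continuous homomorphic section with image `H` (the continuous bijection `H → G ⧸ P` is a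
homeomorphism). [cite: RibesZalesskii2010, §2.3 (Thm 2.3.15 and the remarks following it)] -/
theorem exists_continuousMonoidHom_section_of_closed_complement (P H : Subgroup G) [P.Normal]
    (hPc : IsClosed (P : Set G)) (hHc : IsClosed (H : Set G)) (hinf : H ⊓ P = ⊥) (hsup : H ⊔ P = ⊤) :
    ∃ s : ContinuousMonoidHom (G ⧸ P) G,
      (∀ q : G ⧸ P, (QuotientGroup.mk (s q) : G ⧸ P) = q) ∧ (s : G ⧸ P →* G).range = H := by
  classical
  haveI : CompactSpace H := isCompact_iff_compactSpace.mp hHc.isCompact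
  haveI : IsClosed (P : Set G) := hPc
  let f : H →* G ⧸ P := (QuotientGroup.mk' P).restrict H
  have hfc : Continuous f := QuotientGroup.continuous_mk.comp continuous_subtype_val
  have hfinj : Function.Injective f := by
    intro a b hab
    have h1 : f (a⁻¹ * b) = 1 := by rw [map_mul, map_inv, hab, inv_mul_cancel]
    have hmem : ((a⁻¹ * b : H) : G) ∈ P := by
      change (QuotientGroup.mk' P ((a⁻¹ * b : H) : G)) = 1 at h1
      rwa [QuotientGroup.mk'_apply, QuotientGroup.eq_one_iff] at h1
    have : ((a⁻¹ * b : H) : G) ∈ H ⊓ P := ⟨(a⁻¹ * b).2, hmem⟩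
    rw [hinf, Subgroup.mem_bot] at this
    have hab' : a⁻¹ * b = 1 := Subtype.ext this
    rw [← mul_right_inj a⁻¹, hab', inv_mul_cancel]
  have hfsurj : Function.Surjective f := by
    rintro ⟨g⟩
    have hg : g ∈ ((H ⊔ P : Subgroup G) : Set G) := by rw [hsup]; exact Set.mem_univ g
    rw [Subgroup.mul_normal] at hg
    obtain ⟨h, hh, q, hq, rfl⟩ := Set.mem_mul.mp hg
    refine ⟨⟨h, hh⟩, ?_⟩
    change (QuotientGroup.mk h : G ⧸ P) = QuotientGroup.mk (h * q)
    rw [QuotientGroup.eq, ← mul_assoc, inv_mul_cancel, one_mul]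
    exact hq
  let e : H ≃* G ⧸ P := MulEquiv.ofBijective f ⟨hfinj, hfsurj⟩
  have hec : Continuous e := hfc
  have hesymm : Continuous e.symm := by
    have h := (Continuous.homeoOfEquivCompactToT2 (f := e.toEquiv) hec).continuous_symm
    exact h
  refine ⟨⟨H.subtype.comp e.symm.toMonoidHom, continuous_subtype_val.comp hesymm⟩, fun q => ?_, ?_⟩
  · change (QuotientGroup.mk ((e.symm q : H) : G) : G ⧸ P) = q
    have : f (e.symm q) = q := e.apply_symm_apply q
    exact this
  · ext x
    constructor
    · rintro ⟨q, rfl⟩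
      exact (e.symm q).2
    · intro hx
      refine ⟨e ⟨x, hx⟩, ?_⟩
      change ((e.symm (e ⟨x, hx⟩) : H) : G) = x
      rw [e.symm_apply_apply]

end Section

variable (F : Type) [Field F] [ValuativeRel F] [TopologicalSpace F] [IsNonarchimedeanLocalField F]

/-! ### The tame structure at the open normal levels of `I_F` -/

/-- An open normal subgroup `W` of `I_F` contains `N ∩ I_F` for some open normal subgroup `N` of `Γ_F`
(more precisely: some open normal `N` of `Γ_F` whose elements lying in `I_F` lie in `W`).
[cite: NeukirchSchmidtWingberg2008, Thm. 7.5.3] -/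
theorem exists_openNormalSubgroup_inf_absInertia_le (W : OpenNormalSubgroup (absInertia F)) :
    ∃ N : OpenNormalSubgroup (absoluteGaloisGroup F),
      ∀ x (hx : x ∈ absInertia F), x ∈ (N : Subgroup (absoluteGaloisGroup F)) → (⟨x, hx⟩ : absInertia F) ∈ W := by
  haveI := absoluteGaloisGroup_compactSpace F
  obtain ⟨O, hO, hOW⟩ := isOpen_induced_iff.mp W.toOpenSubgroup.isOpen
  have h1 : (1 : absoluteGaloisGroup F) ∈ O := by
    have : (1 : absInertia F) ∈ Subtype.val ⁻¹' O := by rw [hOW]; exact one_mem W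
    exact this
  obtain ⟨N, hN⟩ := ProfiniteGrp.exist_openNormalSubgroup_sub_open_nhds_of_one hO h1
  refine ⟨N, fun x hx hxN => ?_⟩
  have : (⟨x, hx⟩ : absInertia F) ∈ Subtype.val ⁻¹' O := hN hxN
  rw [hOW] at this
  exact this

/-- **`P_F` is pro-`p` at the levels of `I_F`**: for every open normal subgroup `W` of `I_F`, the image
of `P_F` (as a subgroup of `I_F`) in `I_F ⧸ W` is a `p`-group, `p` the residue characteristic.
[cite: SerreLocalFields1979, Ch. IV §2 Cor. 3 of Prop. 7] -/
theorem isPGroup_map_absWildInertia_subgroupOf {ϖ : 𝒪[F]} (hϖ : Irreducible ϖ)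
    (W : OpenNormalSubgroup (absInertia F)) :
    IsPGroup (ringChar 𝓀[F]) (((absWildInertia F ϖ).subgroupOf (absInertia F)).map
      (QuotientGroup.mk' (W : Subgroup (absInertia F)))) := by
  obtain ⟨N, hN⟩ := exists_openNormalSubgroup_inf_absInertia_le F W
  rintro ⟨_, ⟨x, hx, rfl⟩⟩
  have hxP : (x : absoluteGaloisGroup F) ∈ absWildInertia F ϖ := Subgroup.mem_subgroupOf.mp hx
  obtain ⟨a, ha⟩ := absWildInertia_pow_mem_of_isOpen F hϖ _ hxP (N : Subgroup (absoluteGaloisGroup F))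
    N.toOpenSubgroup.isOpen
  refine ⟨a, ?_⟩
  apply Subtype.ext
  change (QuotientGroup.mk' (W : Subgroup (absInertia F)) x) ^ (ringChar 𝓀[F] ^ a) = 1
  rw [← map_pow, QuotientGroup.mk'_apply, QuotientGroup.eq_one_iff]
  have hxW := hN ((x : absoluteGaloisGroup F) ^ (ringChar 𝓀[F] ^ a)) (Subgroup.pow_mem _ x.2 _) ha
  have hxe : x ^ (ringChar 𝓀[F] ^ a) =
      ⟨(x : absoluteGaloisGroup F) ^ (ringChar 𝓀[F] ^ a), Subgroup.pow_mem _ x.2 _⟩ :=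
    Subtype.ext (Subgroup.coe_pow _ _ _)
  rw [hxe]
  exact hxW

/-- **`I_F ⧸ P_F` is pro-`p′` at the levels of `I_F`** (characteristic `0`): for every open normal
subgroup `W` of `I_F`, the index of the image of `P_F` in `I_F ⧸ W` is prime to `p`: it divides
`[I_F : I_F ∩ N P_F] = |im(I_F → Γ_F ⧸ N P_F)|` for a suitable open normal `N` of `Γ_F`, which is prime to
`p` by `isCyclic_map_absInertia_of_absWildInertia_le`. [cite: SerreLocalFields1979, Ch. IV §2 Cor. 1 of Prop. 7] -/
theorem coprime_index_map_absWildInertia_subgroupOf [CharZero F] {ϖ : 𝒪[F]} (hϖ : Irreducible ϖ)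
    (W : OpenNormalSubgroup (absInertia F)) :
    Nat.Coprime (ringChar 𝓀[F]) (((absWildInertia F ϖ).subgroupOf (absInertia F)).map
      (QuotientGroup.mk' (W : Subgroup (absInertia F)))).index := by
  classical
  haveI := absoluteGaloisGroup_compactSpace F
  haveI : (absWildInertia F ϖ).Normal := absWildInertia_normal F ϖ
  haveI hP₁n : ((absWildInertia F ϖ).subgroupOf (absInertia F)).Normal := inferInstance
  -- the index of the image is `[I_F : P₁ W]`
  have hidx : (((absWildInertia F ϖ).subgroupOf (absInertia F)).map
        (QuotientGroup.mk' (W : Subgroup (absInertia F)))).index =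
      ((absWildInertia F ϖ).subgroupOf (absInertia F) ⊔ (W : Subgroup (absInertia F))).index := by
    rw [Subgroup.index_map, QuotientGroup.ker_mk',
      MonoidHom.range_eq_top.mpr (QuotientGroup.mk'_surjective _), Subgroup.index_top, mul_one]
  rw [hidx]
  -- an open normal `N` of `Γ_F` with `N ∩ I_F ⊆ P₁ W`, and `U = N P ⊇ P`
  let W' : OpenNormalSubgroup (absInertia F) :=
    { toSubgroup := (absWildInertia F ϖ).subgroupOf (absInertia F) ⊔ (W : Subgroup (absInertia F))
      isOpen' := Subgroup.isOpen_mono le_sup_right W.toOpenSubgroup.isOpen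
      isNormal' := Subgroup.sup_normal _ _ }
  obtain ⟨N, hN⟩ := exists_openNormalSubgroup_inf_absInertia_le F W'
  let U : OpenNormalSubgroup (absoluteGaloisGroup F) :=
    { toSubgroup := (N : Subgroup (absoluteGaloisGroup F)) ⊔ absWildInertia F ϖ
      isOpen' := Subgroup.isOpen_mono le_sup_left N.toOpenSubgroup.isOpen
      isNormal' := Subgroup.sup_normal _ _ }
  have hPU : absWildInertia F ϖ ≤ U.toSubgroup := le_sup_right
  -- `U ∩ I_F ⊆ P₁ W` inside `I_F`
  have hUI : (U.toSubgroup).subgroupOf (absInertia F) ≤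
      (absWildInertia F ϖ).subgroupOf (absInertia F) ⊔ (W : Subgroup (absInertia F)) := by
    intro x hx
    rw [Subgroup.mem_subgroupOf] at hx
    have hx' : (x : absoluteGaloisGroup F) ∈ (((N : Subgroup (absoluteGaloisGroup F)) ⊔
        absWildInertia F ϖ : Subgroup (absoluteGaloisGroup F)) : Set (absoluteGaloisGroup F)) := hx
    rw [Subgroup.normal_mul] at hx'
    obtain ⟨n, hn, q, hq, hnq⟩ := Set.mem_mul.mp hx'
    have hqI : q ∈ absInertia F := absWildInertia_le_absInertia F ϖ hq
    have hnI : n ∈ absInertia F := by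
      have : n = (x : absoluteGaloisGroup F) * q⁻¹ := by rw [← hnq, mul_inv_cancel_right]
      rw [this]
      exact mul_mem x.2 (inv_mem hqI)
    have hnW' : (⟨n, hnI⟩ : absInertia F) ∈ W' := hN n hnI hn
    have hqP₁ : (⟨q, hqI⟩ : absInertia F) ∈ (absWildInertia F ϖ).subgroupOf (absInertia F) :=
      Subgroup.mem_subgroupOf.mpr hq
    have hxeq : x = ⟨n, hnI⟩ * ⟨q, hqI⟩ := Subtype.ext hnq.symm
    rw [hxeq]
    exact mul_mem hnW' (Subgroup.mem_sup_left hqP₁)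
  -- hence `[I_F : P₁ W] ∣ [I_F : U ∩ I_F] = |im(I_F → Γ_F ⧸ U)|`, which is prime to `p`
  have hdvd : ((absWildInertia F ϖ).subgroupOf (absInertia F) ⊔ (W : Subgroup (absInertia F))).index ∣
      ((U.toSubgroup).subgroupOf (absInertia F)).index :=
    Subgroup.index_dvd_of_le hUI
  have hcard : ((U.toSubgroup).subgroupOf (absInertia F)).index =
      Nat.card ((absInertia F).map (QuotientGroup.mk' U.toSubgroup)) := by
    rw [← Subgroup.relIndex_ker (absInertia F) (QuotientGroup.mk' U.toSubgroup), QuotientGroup.ker_mk']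
    rfl
  have hcop := (isCyclic_map_absInertia_of_absWildInertia_le F hϖ.ne_zero U hPU).2
  rw [← hcard] at hcop
  exact (hcop.symm).coprime_dvd_right hdvd

/-! ### The unramified quotient -/

/-- **A Frobenius and `I_F` topologically generate `Γ_F`**: `cl⟨φ⟩ ⊔ I_F = Γ_F` for any `φ` with
`IsFrobPow φ 1`. [cite: NeukirchSchmidtWingberg2008, Thm. 7.5.3] -/
theorem topologicalClosure_zpowers_sup_absInertia_eq_top {φ : absoluteGaloisGroup F}
    (hφ : IsFrobPow φ 1) :
    (Subgroup.zpowers φ).topologicalClosure ⊔ absInertia F = ⊤ := by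
  classical
  haveI := absoluteGaloisGroup_compactSpace F
  haveI : (absInertia F).Normal := absInertia_normal_holds F
  rw [← galUnr_eq_absInertia]
  haveI : (galUnr F).Normal := by rw [galUnr_eq_absInertia]; exact absInertia_normal_holds F
  set M : Subgroup (absoluteGaloisGroup F) := (Subgroup.zpowers φ).topologicalClosure ⊔ galUnr F with hM
  have hMc : IsClosed (M : Set (absoluteGaloisGroup F)) := by
    rw [hM, Subgroup.mul_normal]
    exact ((Subgroup.isClosed_topologicalClosure _).isCompact.mul
      (isClosed_galUnr F).isCompact).isClosed
  -- the image of `M` in `Gal(F^nr/F)` is closed and contains the dense `⟨φ̄⟩`, hence is everything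
  have himc : IsClosed ((QuotientGroup.mk : absoluteGaloisGroup F → absoluteGaloisGroup F ⧸ galUnr F) ''
      (M : Set (absoluteGaloisGroup F))) :=
    (hMc.isCompact.image QuotientGroup.continuous_mk).isClosed
  have hsub : (Subgroup.zpowers (QuotientGroup.mk φ : absoluteGaloisGroup F ⧸ galUnr F) :
      Set (absoluteGaloisGroup F ⧸ galUnr F)) ⊆
        (QuotientGroup.mk : absoluteGaloisGroup F → absoluteGaloisGroup F ⧸ galUnr F) ''
          (M : Set (absoluteGaloisGroup F)) := by
    rintro _ ⟨n, rfl⟩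
    exact ⟨φ ^ n, Subgroup.mem_sup_left (Subgroup.le_topologicalClosure _ ⟨n, rfl⟩),
      by simp⟩
  have hall : (QuotientGroup.mk : absoluteGaloisGroup F → absoluteGaloisGroup F ⧸ galUnr F) ''
      (M : Set (absoluteGaloisGroup F)) = Set.univ := by
    apply Set.eq_univ_of_univ_subset
    rw [← (dense_zpowers_mk_of_isFrobPow hφ).closure_eq]
    exact closure_minimal hsub himc
  rw [eq_top_iff]
  intro g _
  obtain ⟨m, hm, hmg⟩ := (Set.eq_univ_iff_forall.mp hall) (QuotientGroup.mk g)
  rw [QuotientGroup.eq] at hmg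
  have : g = m * (m⁻¹ * g) := by rw [mul_inv_cancel_left]
  rw [this]
  exact mul_mem hm (Subgroup.mem_sup_right hmg)

/-- Transport of free procyclicity of a quotient along an equality of normal subgroups. [folklore] -/
private theorem isFreeProcyclic_quotient_congr {G : Type*} [Group G] [TopologicalSpace G]
    {A B : Subgroup G} [A.Normal] [B.Normal] (h : A = B)
    (hf : FundamentalExtension.IsFreeProcyclic (G ⧸ A)) : FundamentalExtension.IsFreeProcyclic (G ⧸ B) := by
  subst h
  exact hf

/-- **`Γ_F ⧸ I_F ≅ Ẑ` is free procyclic** (transport of `isFreeProcyclic_quotient_galUnr` along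
`galUnr_eq_absInertia`). [cite: NeukirchSchmidtWingberg2008, Thm. 7.5.3] -/
theorem isFreeProcyclic_quotient_absInertia :
    FundamentalExtension.IsFreeProcyclic (absoluteGaloisGroup F ⧸ absInertia F) := by
  haveI : (absInertia F).Normal := absInertia_normal_holds F
  haveI : (galUnr F).Normal := by rw [galUnr_eq_absInertia]; exact absInertia_normal_holds F
  exact isFreeProcyclic_quotient_congr (galUnr_eq_absInertia (F := F)) (isFreeProcyclic_quotient_galUnr F)

/-! ### The splitting -/

/-- **The wild inertia sequence splits**: for `F` of characteristic `0` and `ϖ` a uniformiser, the wild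
inertia group `P_F = absWildInertia F ϖ` has a CLOSED COMPLEMENT in `Γ_F` — a closed subgroup `H`
with `H ⊓ P_F = ⊥` and `H ⊔ P_F = ⊤`, so that `Γ_F = P_F ⋊ H` with `H ≅ Γ_F ⧸ P_F = Gal(F^tr/F)`.
(Profinite Schur–Zassenhaus for `P_F ⊴ I_F`, Frattini argument, and a procyclic Frobenius lift:
`Literature.GroupTheory.exists_closed_complement_of_procyclic_quotient`.)
[cite: NeukirchSchmidtWingberg2008, Thm. 7.5.3] [cite: JannsenWingberg1982, §1] -/
theorem exists_closed_complement_absWildInertia [CharZero F] {ϖ : 𝒪[F]} (hϖ : Irreducible ϖ) :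
    ∃ H : Subgroup (absoluteGaloisGroup F), IsClosed (H : Set (absoluteGaloisGroup F)) ∧
      H ⊓ absWildInertia F ϖ = ⊥ ∧ H ⊔ absWildInertia F ϖ = ⊤ := by
  classical
  haveI := absoluteGaloisGroup_compactSpace F
  haveI hp : Fact (ringChar 𝓀[F]).Prime := ⟨ringChar_residueField_prime (F := F)⟩
  haveI : (absWildInertia F ϖ).Normal := absWildInertia_normal F ϖ
  haveI : (absInertia F).Normal := absInertia_normal_holds F
  obtain ⟨φ, hφ⟩ := exists_isFrobPow_holds (F := F) 1
  exact exists_closed_complement_of_procyclic_quotient (p := ringChar 𝓀[F]) (absWildInertia F ϖ)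
    (absInertia F) (MLFGaloisTameStronglyComplete.isClosed_absWildInertia F ϖ) (isClosed_absInertia_holds F)
    (absWildInertia_le_absInertia F ϖ) (isPGroup_map_absWildInertia_subgroupOf F hϖ)
    (coprime_index_map_absWildInertia_subgroupOf F hϖ)
    ⟨φ, topologicalClosure_zpowers_sup_absInertia_eq_top F hφ⟩
    (fun ψ hψ => topologicalClosure_zpowers_inf_eq_bot_of_isFreeProcyclic (absInertia F)
      (isFreeProcyclic_quotient_absInertia F) ψ hψ)

/-- **A continuous splitting of `Γ_F → Gal(F^tr/F)`**: there is a continuous homomorphic section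
`s : Γ_F ⧸ P_F → Γ_F` of the projection, whose image is a closed complement of `P_F`.
[cite: NeukirchSchmidtWingberg2008, Thm. 7.5.3] [cite: JannsenWingberg1982, §1] -/
theorem exists_continuous_section_absWildInertia [CharZero F] {ϖ : 𝒪[F]} (hϖ : Irreducible ϖ)
    [(absWildInertia F ϖ).Normal] :
    ∃ s : ContinuousMonoidHom (absoluteGaloisGroup F ⧸ absWildInertia F ϖ) (absoluteGaloisGroup F),
      ∀ q, (QuotientGroup.mk (s q) : absoluteGaloisGroup F ⧸ absWildInertia F ϖ) = q := by
  haveI := absoluteGaloisGroup_compactSpace F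
  obtain ⟨H, hHc, hHinf, hHsup⟩ := exists_closed_complement_absWildInertia F hϖ
  obtain ⟨s, hs, -⟩ := exists_continuousMonoidHom_section_of_closed_complement (absWildInertia F ϖ) H
    (MLFGaloisTameStronglyComplete.isClosed_absWildInertia F ϖ) hHc hHinf hHsup
  exact ⟨s, hs⟩

/-- **Second route to «`P_F` is topologically normally finitely generated»**: if `Γ_F` is
topologically finitely generated (unconditional in characteristic `0`:
`Summits/ABC/IUTFork/MLFGaloisTFG.lean`), the wild inertia group is topologically generated by the
`Γ_F`-conjugates of a finite subset — via the splitting `exists_closed_complement_absWildInertia` and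
`Literature.GroupTheory.exists_normalGenerators_of_closed_complement`; compare the Jannsen–Wingberg
count `exists_topologicalClosure_normalClosure_eq_absWildInertia` (`d + 2` generators).
[cite: NeukirchSchmidtWingberg2008, Thm. 7.5.3] [cite: JannsenWingberg1982, §1] -/
theorem exists_normalGenerators_absWildInertia_of_tfg [CharZero F]
    (hG : IsTopologicallyFinitelyGenerated (absoluteGaloisGroup F)) {ϖ : 𝒪[F]} (hϖ : Irreducible ϖ) :
    ∃ E : Finset (absoluteGaloisGroup F), (E : Set (absoluteGaloisGroup F)) ⊆ absWildInertia F ϖ ∧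
      absWildInertia F ϖ ≤ (Subgroup.closure {y : absoluteGaloisGroup F |
        ∃ g : absoluteGaloisGroup F, ∃ e ∈ E, y = g * e * g⁻¹}).topologicalClosure := by
  classical
  haveI := absoluteGaloisGroup_compactSpace F
  haveI : (absWildInertia F ϖ).Normal := absWildInertia_normal F ϖ
  obtain ⟨H, hHc, hHinf, hHsup⟩ := exists_closed_complement_absWildInertia F hϖ
  exact exists_normalGenerators_of_closed_complement hG (absWildInertia F ϖ) H
    (MLFGaloisTameStronglyComplete.isClosed_absWildInertia F ϖ) hHc hHsup hHinf

end Literature.NumberTheory.GaloisRepresentations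

end
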